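import Summits.QuantumFields.BalabanUV.Beta.GAN24.SourceSideRate
import Summits.QuantumFields.BalabanUV.Beta.GAN24.ClosedFormRateOfParts

/-!
# `BalabanUV.Beta.GAN24.SourceSideRatePhi` — binder row G-an2-4 / (CONV-C), road P1-fibre, sub-part **PART S** of gan24-p1's row
# **P1-L11** `FibreRate` (leaf-20-g7's division, CLAIMS l.3039; TAKE l.3074) — PART 5: the label-level TWO-LEVEL RATE of the `S_φ` model
# (matched labels and tail; `p`-UNIFORM at the zero alias)

NOT IN PRINT; OUR PROOF ATTEMPT.  HONEST FRAMING (cell contract, verbatim): «discharging `BetaPertH` makes Bałaban's UV stability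
UNCONDITIONAL — a real constructive-QFT result; it is NOT the continuum limit and NOT the Clay problem.»  HONEST DEPENDENCY (verbatim):
«continuum YM on T⁴ ⇐ BetaPertH ∧ nine spine estimates (0/9 proved); BetaPertH ⇐ (D1) ∧ (D4) ∧ CAP+tail; G-an2-4 gates asym, D1 and
NE2/3/4.»  [folklore] explicit real analysis (product telescoping `ClosedFormRateOfParts.norm_mul_sub_mul_le` of row Y11d BY NAME); 0 cite, 0 wall binder, no `def … : Prop`, no new `def`.  It discharges NOTHING of (CONV-C)'s
K-slot `GAN24.CombesThomas.ConvCK 3 Lc` by itself.  NOT `BetaPertH`, NOT continuum, NOT Clay.  Value = kernel bookkeeping toward the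
K-slot route P1 of binder row G-an2-4, NOT summit progress.

## What is proved (`q ∈ [−π, π]^D ∖ {0}`, two steps `N = M·Lc ≤ N′ = M′·Lc`, label `Q = q + 2πz`)
The `S_φ` label model splits as `termPhi = −srcPh·(δ-part − projector part)` with `δ-part = [l′ = l]·(Π_i P)(P_l)·(symN⁻¹/2)` and
`projector part = (Lc·∂̂(p)_{l′}·eM)·((Π_i P)·(symN⁻²/2))` (`termPhi_eq_mul`).  Matched-label rates:
* `norm_deltaPart_sub_le`: `≤ [z = 0]·(π⁴/96 + π²/48)/N² + (π²/48)((D+1)Lc + 1)/N² · Π_i mP Lc z_i` — at the zero alias the paired-factor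
  rates carry `q_i²` (`norm_prod_pairP_sub_le_zero`, `norm_pairP_sub_le_sq`), which cancel the `1/|q|²` of `symN⁻¹`: `p`-UNIFORM;
* `norm_projPart_sub_le`: `≤ [z = 0]·(π⁶/768 + π⁴/96)/N² + (π²/48)(D·Lc² + 2Lc)/N² · Π_i mP Lc z_i` (the prefactor `Lc·|∂̂_{l′}|·|eM|`
  is `≤ |q|²` at the zero alias and `≤ 4Lc` elsewhere);
* **`norm_termPhi_sub_le`**: the sum of the two; **`norm_termPhi_tail_le`**: `‖termPhi_{N′}(Q)‖ ≤ ((1 + Lc)/8)/N² · Π_i mP Lc z_i` for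
  labels of `boxZ N′ q ∖ boxZ N q` (`|Q|² ≥ π²N²`).
The assembled rate of `srcPhi` is part 6 (`SourceSideRatePhiSum`).

Unit `b2b-balaban-gan24-formalise-leaf-07` (G-an2-4 formalisation swarm, leaf prover 07, gen 6), 2026-08-20.
-/

noncomputable section

open Complex Finset
open scoped BigOperators Real

namespace Summit.QuantumFields.BalabanUV.Beta.GAN24.SourceSideRatePhi

open Literature.Probability.LatticeModels (TorusSite)
open Literature.MathematicalPhysics.QuantumFieldTheory.Balaban1983to89.B4Strip (ofRealVec)
open Literature.MathematicalPhysics.QuantumFieldTheory.King1986 (momSq momSq_nonneg)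
open FibreSymbols (dhat dflat lapSym)
open CapacitanceScalarRate CapacitanceScalarRateTerm CapacitanceScalarRateBox CapacitanceScalarRateSum
open SourceSidePair SourceSideMajorant SourceSideDict SourceSideBound SourceSideRate
open AliasObjects (srcPhi srcC fhatF)

variable {D : ℕ}

/-! ## §1 Product form of the `S_φ` label model -/

section Labels

variable {N M N' M' Lc : ℕ} [NeZero N] [NeZero M] [NeZero N'] [NeZero M'] [NeZero Lc]

omit [NeZero N] [NeZero M] [NeZero Lc] in
/-- [folklore] `termPhi = −srcPh · (δ-part − projector part)` with real inverse-symbol factors pulled out. -/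
theorem termPhi_eq_mul (q : Fin D → ℝ) (l' l : Fin D) (y' : Fin D → ℤ) (Q : Fin D → ℝ) :
    termPhi N M Lc q l' l y' Q = -(srcPh Lc y' Q *
      ((if l' = l then (∏ i, pairP N M (Q i)) * pairP N M (Q l) * ((((symN N Q)⁻¹ / 2 : ℝ)) : ℂ) else 0)
        - ((Lc : ℂ) * dhat (ofRealVec q) l' * eM Lc (Q l)) * ((∏ i, pairP N M (Q i)) * ((((symN N Q)⁻¹ ^ 2 / 2 : ℝ)) : ℂ)))) := by
  unfold termPhi
  congr 1
  split_ifs with h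
  · push_cast
    ring
  · push_cast
    ring

/-- **RATE OF THE `δ`-PART** (matched labels; `p`-uniform at the zero alias). -/
theorem norm_deltaPart_sub_le (hNM : N = M * Lc) (hN'M' : N' = M' * Lc) (hNN' : N ≤ N') {q : Fin D → ℝ} (hq : ∀ i, |q i| ≤ π)
    (hq0 : q ≠ 0) (l : Fin D) {z : Fin D → ℤ} (hz : z ∈ boxZ N q) :
    ‖(∏ i, pairP N' M' (qv q z i)) * pairP N' M' (qv q z l) * ((((symN N' (qv q z))⁻¹ / 2 : ℝ)) : ℂ)
        - (∏ i, pairP N M (qv q z i)) * pairP N M (qv q z l) * ((((symN N (qv q z))⁻¹ / 2 : ℝ)) : ℂ)‖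
      ≤ (if z = 0 then (π ^ 4 / 96 + π ^ 2 / 48) / (N : ℝ) ^ 2 else 0)
        + π ^ 2 / 48 * ((D + 1) * (Lc : ℝ) + 1) / (N : ℝ) ^ 2 * ∏ i, mP Lc (z i) := by
  classical
  have hN : 0 < N := Nat.pos_of_ne_zero (NeZero.ne N)
  have hM : 0 < M := Nat.pos_of_ne_zero (NeZero.ne M)
  have hN' : 0 < N' := Nat.pos_of_ne_zero (NeZero.ne N')
  have hM' : 0 < M' := Nat.pos_of_ne_zero (NeZero.ne M')
  have hLc : 0 < Lc := Nat.pos_of_ne_zero (NeZero.ne Lc)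
  have hLc1 : 1 ≤ Lc := hLc
  have hLcr : (0 : ℝ) < Lc := by exact_mod_cast hLc
  have hNr : (0 : ℝ) < N := by exact_mod_cast hN
  have hNMr : (N : ℝ) = M * Lc := by exact_mod_cast hNM
  have hN'M'r : (N' : ℝ) = M' * Lc := by exact_mod_cast hN'M'
  have hπ := Real.pi_pos
  have hQ : ∀ i, |qv q z i| ≤ π * N := abs_qv_le_of_mem_boxZ hq hz
  have hz' : z ∈ boxZ N' q := boxZ_subset hq hNN' hz
  have hQ' : ∀ i, |qv q z i| ≤ π * N' := abs_qv_le_of_mem_boxZ hq hz'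
  obtain ⟨hS, hS', hSinv, hS'inv, hrate⟩ := symN_two_level hNN' hq hq0 hz
  have hmQ : 0 < momSq (qv q z) := momSq_qv_pos hq hq0 z
  have hP : ‖∏ i, pairP N M (qv q z i)‖ ≤ ∏ i, mP Lc (z i) := norm_prod_pairP_le hN hM hLc hNMr hq hQ
  have hPm := prod_mP_nonneg Lc z
  have hPl : ‖pairP N M (qv q z l)‖ ≤ 1 := norm_pairP_le_one hN hM _
  have hPl' : ‖pairP N' M' (qv q z l)‖ ≤ 1 := norm_pairP_le_one hN' hM' _
  have hsplit := norm_mul_real_sub_le ((∏ i, pairP N' M' (qv q z i)) * pairP N' M' (qv q z l))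
    ((∏ i, pairP N M (qv q z i)) * pairP N M (qv q z l)) ((symN N (qv q z))⁻¹ / 2)
    (by positivity : (0 : ℝ) ≤ (symN N' (qv q z))⁻¹ / 2)
  have hAB := ClosedFormRateOfParts.norm_mul_sub_mul_le (∏ i, pairP N M (qv q z i)) (∏ i, pairP N' M' (qv q z i)) (pairP N M (qv q z l))
    (pairP N' M' (qv q z l))
  have hu : |(symN N' (qv q z))⁻¹ / 2 - (symN N (qv q z))⁻¹ / 2| ≤ π ^ 2 / 48 / (N : ℝ) ^ 2 := by
    rw [← sub_div, abs_div, abs_two]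
    calc |(symN N' (qv q z))⁻¹ - (symN N (qv q z))⁻¹| / 2 ≤ (π ^ 2 / 24 / (N : ℝ) ^ 2) / 2 := by gcongr
      _ = π ^ 2 / 48 / (N : ℝ) ^ 2 := by ring
  have hnormAB : ‖(∏ i, pairP N M (qv q z i)) * pairP N M (qv q z l)‖ ≤ ∏ i, mP Lc (z i) := by
    rw [norm_mul]; calc _ ≤ (∏ i, mP Lc (z i)) * 1 := mul_le_mul hP hPl (norm_nonneg _) hPm
      _ = _ := mul_one _
  by_cases hz0 : z = 0
  · subst hz0
    rw [if_pos rfl]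
    have hq' : qv q (0 : Fin D → ℤ) = q := qv_zero q
    rw [hq'] at hS hS' hSinv hS'inv hrate hmQ hP hPl hPl' hsplit hAB hu hnormAB ⊢
    rw [prod_mP_zero] at hP hnormAB ⊢
    set m := momSq q with hm_def
    have hql : q l ^ 2 ≤ m := Finset.single_le_sum (f := fun i => q i ^ 2) (fun i _ => sq_nonneg _) (Finset.mem_univ l)
    have hA : ‖∏ i, pairP N' M' (q i) - ∏ i, pairP N M (q i)‖ ≤ π ^ 2 / 24 * m / (N : ℝ) ^ 2 :=
      norm_prod_pairP_sub_le_zero hN hM hN' hM' hLc hNMr hN'M'r hNN' hq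
    have hN1 : (1 : ℝ) ≤ N := by exact_mod_cast hN
    have hqlN : |q l| ≤ π * N := (hq l).trans (by nlinarith)
    have hB : ‖pairP N' M' (q l) - pairP N M (q l)‖ ≤ π ^ 2 / 24 * m / (N : ℝ) ^ 2 :=
      (norm_pairP_sub_le_sq hN hM hN' hM' hLc hNMr hN'M'r hNN' hqlN).trans
        (by gcongr)
    have hu' : (symN N' q)⁻¹ / 2 ≤ π ^ 2 / 8 * m⁻¹ := by linarith
    have hABle : ‖(∏ i, pairP N' M' (q i)) * pairP N' M' (q l) - (∏ i, pairP N M (q i)) * pairP N M (q l)‖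
        ≤ π ^ 2 / 24 * m / (N : ℝ) ^ 2 * 1 + 1 * (π ^ 2 / 24 * m / (N : ℝ) ^ 2) :=
      hAB.trans (add_le_add (mul_le_mul hA hPl' (norm_nonneg _) (by positivity)) (mul_le_mul hP hB (norm_nonneg _) zero_le_one))
    calc _ ≤ (π ^ 2 / 24 * m / (N : ℝ) ^ 2 * 1 + 1 * (π ^ 2 / 24 * m / (N : ℝ) ^ 2)) * (π ^ 2 / 8 * m⁻¹)
          + 1 * (π ^ 2 / 48 / (N : ℝ) ^ 2) :=
          hsplit.trans (add_le_add (mul_le_mul hABle hu' (by positivity) (by positivity))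
            (mul_le_mul hnormAB hu (abs_nonneg _) zero_le_one))
      _ = (π ^ 4 / 96 + π ^ 2 / 48) / (N : ℝ) ^ 2 := by field_simp; ring
      _ ≤ _ := by
          have : 0 ≤ π ^ 2 / 48 * ((D + 1) * (Lc : ℝ) + 1) / (N : ℝ) ^ 2 * 1 := by positivity
          linarith
  · rw [if_neg hz0, zero_add]
    obtain ⟨hq4', hq4, hm1⟩ := inv_symN_le_off_zero hNN' hq hq0 hz hz0
    have hA : ‖∏ i, pairP N' M' (qv q z i) - ∏ i, pairP N M (qv q z i)‖
        ≤ π ^ 2 / 6 * Lc / (N : ℝ) ^ 2 * ∑ i, ∏ j ∈ Finset.univ.erase i, mP Lc (z j) :=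
      norm_prod_pairP_sub_le hN hM hN' hM' hLc hNMr hN'M'r hNN' hq hQ
    have hB : ‖pairP N' M' (qv q z l) - pairP N M (qv q z l)‖ ≤ π ^ 2 / 6 * Lc / (N : ℝ) ^ 2 :=
      norm_pairP_sub_le_unif hN hM hN' hM' hLc hNMr hN'M'r hNN' (hQ l)
    have hu8 : ∀ i, 8 * ((symN N' (qv q z))⁻¹ / 2) ≤ mP Lc (z i) := fun i => by
      have h2 : (momSq (qv q z))⁻¹ ≤ mP Lc (z i) / π ^ 2 := inv_momSq_qv_le hLc1 hq hz0 i
      calc 8 * ((symN N' (qv q z))⁻¹ / 2) = 4 * (symN N' (qv q z))⁻¹ := by ring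
        _ ≤ 4 * (π ^ 2 / 4 * (momSq (qv q z))⁻¹) := by gcongr
        _ ≤ 4 * (π ^ 2 / 4 * (mP Lc (z i) / π ^ 2)) := by gcongr
        _ = mP Lc (z i) := by field_simp
    have hborrow := sum_prod_erase_mul_le z hu8
    have hu'8 : (symN N' (qv q z))⁻¹ / 2 ≤ 1 / 8 := by linarith
    -- Term A: the `D`-fold product differenced
    have hTA : ‖∏ i, pairP N' M' (qv q z i) - ∏ i, pairP N M (qv q z i)‖ * ‖pairP N' M' (qv q z l)‖ *
        ((symN N' (qv q z))⁻¹ / 2) ≤ π ^ 2 / 6 * Lc / (N : ℝ) ^ 2 * (D * ∏ j, mP Lc (z j)) / 8 := by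
      have hA0 : 0 ≤ π ^ 2 / 6 * Lc / (N : ℝ) ^ 2 * ∑ i, ∏ j ∈ Finset.univ.erase i, mP Lc (z j) := (norm_nonneg _).trans hA
      calc _ ≤ (π ^ 2 / 6 * Lc / (N : ℝ) ^ 2 * ∑ i, ∏ j ∈ Finset.univ.erase i, mP Lc (z j)) * 1 *
            ((symN N' (qv q z))⁻¹ / 2) :=
            mul_le_mul_of_nonneg_right (mul_le_mul hA hPl' (norm_nonneg _) hA0) (by positivity)
        _ = π ^ 2 / 6 * Lc / (N : ℝ) ^ 2 *
            ((∑ i, ∏ j ∈ Finset.univ.erase i, mP Lc (z j)) * (8 * ((symN N' (qv q z))⁻¹ / 2))) / 8 := by ring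
        _ ≤ π ^ 2 / 6 * Lc / (N : ℝ) ^ 2 * (D * ∏ j, mP Lc (z j)) / 8 := by gcongr
    -- Term B: the extra paired factor differenced
    have hTB : ‖∏ i, pairP N M (qv q z i)‖ * ‖pairP N' M' (qv q z l) - pairP N M (qv q z l)‖ * ((symN N' (qv q z))⁻¹ / 2)
        ≤ (∏ j, mP Lc (z j)) * (π ^ 2 / 6 * Lc / (N : ℝ) ^ 2) * (1 / 8) := by gcongr
    -- Term U: the inverse symbol differenced
    have hTU : ‖(∏ i, pairP N M (qv q z i)) * pairP N M (qv q z l)‖ * |(symN N' (qv q z))⁻¹ / 2 - (symN N (qv q z))⁻¹ / 2|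
        ≤ (∏ j, mP Lc (z j)) * (π ^ 2 / 48 / (N : ℝ) ^ 2) := mul_le_mul hnormAB hu (abs_nonneg _) hPm
    have hABu : ‖(∏ i, pairP N' M' (qv q z i)) * pairP N' M' (qv q z l) - (∏ i, pairP N M (qv q z i)) * pairP N M (qv q z l)‖ *
        ((symN N' (qv q z))⁻¹ / 2)
        ≤ π ^ 2 / 6 * Lc / (N : ℝ) ^ 2 * (D * ∏ j, mP Lc (z j)) / 8 + (∏ j, mP Lc (z j)) * (π ^ 2 / 6 * Lc / (N : ℝ) ^ 2) * (1 / 8) := by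
      calc _ ≤ (‖∏ i, pairP N' M' (qv q z i) - ∏ i, pairP N M (qv q z i)‖ * ‖pairP N' M' (qv q z l)‖
              + ‖∏ i, pairP N M (qv q z i)‖ * ‖pairP N' M' (qv q z l) - pairP N M (qv q z l)‖) * ((symN N' (qv q z))⁻¹ / 2) :=
            mul_le_mul_of_nonneg_right hAB (by positivity)
        _ = _ := by rw [add_mul]
        _ ≤ _ := add_le_add hTA hTB
    calc _ ≤ (π ^ 2 / 6 * Lc / (N : ℝ) ^ 2 * (D * ∏ j, mP Lc (z j)) / 8 + (∏ j, mP Lc (z j)) * (π ^ 2 / 6 * Lc / (N : ℝ) ^ 2) * (1 / 8))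
          + (∏ j, mP Lc (z j)) * (π ^ 2 / 48 / (N : ℝ) ^ 2) := hsplit.trans (add_le_add hABu hTU)
      _ = π ^ 2 / 48 * ((D + 1) * (Lc : ℝ) + 1) / (N : ℝ) ^ 2 * ∏ i, mP Lc (z i) := by ring

/-- **RATE OF THE PROJECTOR PART** (matched labels; `p`-uniform at the zero alias). -/
theorem norm_projPart_sub_le (hNM : N = M * Lc) (hN'M' : N' = M' * Lc) (hNN' : N ≤ N') {q : Fin D → ℝ} (hq : ∀ i, |q i| ≤ π)
    (hq0 : q ≠ 0) (l' l : Fin D) {z : Fin D → ℤ} (hz : z ∈ boxZ N q) :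
    ‖((Lc : ℂ) * dhat (ofRealVec q) l' * eM Lc (qv q z l)) *
        ((∏ i, pairP N' M' (qv q z i)) * ((((symN N' (qv q z))⁻¹ ^ 2 / 2 : ℝ)) : ℂ)
          - (∏ i, pairP N M (qv q z i)) * ((((symN N (qv q z))⁻¹ ^ 2 / 2 : ℝ)) : ℂ))‖
      ≤ (if z = 0 then (π ^ 6 / 768 + π ^ 4 / 96) / (N : ℝ) ^ 2 else 0)
        + π ^ 2 / 48 * (D * (Lc : ℝ) ^ 2 + 2 * Lc) / (N : ℝ) ^ 2 * ∏ i, mP Lc (z i) := by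
  classical
  have hN : 0 < N := Nat.pos_of_ne_zero (NeZero.ne N)
  have hM : 0 < M := Nat.pos_of_ne_zero (NeZero.ne M)
  have hN' : 0 < N' := Nat.pos_of_ne_zero (NeZero.ne N')
  have hM' : 0 < M' := Nat.pos_of_ne_zero (NeZero.ne M')
  have hLc : 0 < Lc := Nat.pos_of_ne_zero (NeZero.ne Lc)
  have hLc1 : 1 ≤ Lc := hLc
  have hLcr : (0 : ℝ) < Lc := by exact_mod_cast hLc
  have hNr : (0 : ℝ) < N := by exact_mod_cast hN
  have hNMr : (N : ℝ) = M * Lc := by exact_mod_cast hNM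
  have hN'M'r : (N' : ℝ) = M' * Lc := by exact_mod_cast hN'M'
  have hπ := Real.pi_pos
  have hQ : ∀ i, |qv q z i| ≤ π * N := abs_qv_le_of_mem_boxZ hq hz
  obtain ⟨hS, hS', hSinv, hS'inv, -⟩ := symN_two_level hNN' hq hq0 hz
  have hw := abs_inv_symN_sq_sub_le hNN' hq hq0 hz
  have hmQ : 0 < momSq (qv q z) := momSq_qv_pos hq hq0 z
  have hP : ‖∏ i, pairP N M (qv q z i)‖ ≤ ∏ i, mP Lc (z i) := norm_prod_pairP_le hN hM hLc hNMr hq hQ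
  have hPm := prod_mP_nonneg Lc z
  rw [norm_mul, norm_mul, norm_mul, Complex.norm_natCast]
  have hsplit := norm_mul_real_sub_le (∏ i, pairP N' M' (qv q z i)) (∏ i, pairP N M (qv q z i))
    ((symN N (qv q z))⁻¹ ^ 2 / 2) (by positivity : (0 : ℝ) ≤ (symN N' (qv q z))⁻¹ ^ 2 / 2)
  have hv : |(symN N' (qv q z))⁻¹ ^ 2 / 2 - (symN N (qv q z))⁻¹ ^ 2 / 2| ≤ π ^ 4 / 96 / (N : ℝ) ^ 2 * (momSq (qv q z))⁻¹ := by
    rw [← sub_div, abs_div, abs_two]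
    calc |(symN N' (qv q z))⁻¹ ^ 2 - (symN N (qv q z))⁻¹ ^ 2| / 2 ≤ (π ^ 4 / 48 / (N : ℝ) ^ 2 * (momSq (qv q z))⁻¹) / 2 := by
          gcongr
      _ = π ^ 4 / 96 / (N : ℝ) ^ 2 * (momSq (qv q z))⁻¹ := by ring
  by_cases hz0 : z = 0
  · subst hz0
    rw [if_pos rfl]
    have hq' : qv q (0 : Fin D → ℤ) = q := qv_zero q
    rw [hq'] at hS hS' hSinv hS'inv hw hmQ hP hsplit hv ⊢
    rw [prod_mP_zero] at hP ⊢
    set m := momSq q with hm_def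
    have hsq : 0 < Real.sqrt m := Real.sqrt_pos.2 hmQ
    have hE : ‖eM Lc (q l)‖ ≤ Real.sqrt m / Lc :=
      (norm_eM_le_abs hLc (q l)).trans (div_le_div_of_nonneg_right (SymbolProjector.abs_apply_le_sqrt_momSq q l) hLcr.le)
    have hd : ‖dhat (ofRealVec q) l'‖ ≤ Real.sqrt m := CapacitanceScalarDictionary.norm_dhat_ofRealVec_le_sqrt q l'
    have hpre : (Lc : ℝ) * ‖dhat (ofRealVec q) l'‖ * ‖eM Lc (q l)‖ ≤ m := by
      calc (Lc : ℝ) * ‖dhat (ofRealVec q) l'‖ * ‖eM Lc (q l)‖ ≤ Lc * Real.sqrt m * (Real.sqrt m / Lc) := by gcongr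
        _ = Real.sqrt m * Real.sqrt m := by field_simp
        _ = m := Real.mul_self_sqrt hmQ.le
    have hA : ‖∏ i, pairP N' M' (q i) - ∏ i, pairP N M (q i)‖ ≤ π ^ 2 / 24 * m / (N : ℝ) ^ 2 :=
      norm_prod_pairP_sub_le_zero hN hM hN' hM' hLc hNMr hN'M'r hNN' hq
    have hv' : (symN N' q)⁻¹ ^ 2 / 2 ≤ (π ^ 2 / 4 * m⁻¹) ^ 2 / 2 :=
      div_le_div_of_nonneg_right (pow_le_pow_left₀ (inv_nonneg.2 hS'.le) hS'inv 2) zero_le_two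
    have hin : ‖(∏ i, pairP N' M' (q i)) * ((((symN N' q)⁻¹ ^ 2 / 2 : ℝ)) : ℂ)
        - (∏ i, pairP N M (q i)) * ((((symN N q)⁻¹ ^ 2 / 2 : ℝ)) : ℂ)‖
        ≤ π ^ 2 / 24 * m / (N : ℝ) ^ 2 * ((π ^ 2 / 4 * m⁻¹) ^ 2 / 2) + 1 * (π ^ 4 / 96 / (N : ℝ) ^ 2 * m⁻¹) :=
      hsplit.trans (add_le_add (mul_le_mul hA hv' (by positivity) (by positivity))
        (mul_le_mul hP hv (abs_nonneg _) zero_le_one))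
    have hin0 : 0 ≤ π ^ 2 / 24 * m / (N : ℝ) ^ 2 * ((π ^ 2 / 4 * m⁻¹) ^ 2 / 2) + 1 * (π ^ 4 / 96 / (N : ℝ) ^ 2 * m⁻¹) := by
      positivity
    calc _ ≤ m * (π ^ 2 / 24 * m / (N : ℝ) ^ 2 * ((π ^ 2 / 4 * m⁻¹) ^ 2 / 2) + 1 * (π ^ 4 / 96 / (N : ℝ) ^ 2 * m⁻¹)) :=
          mul_le_mul hpre hin (norm_nonneg _) hmQ.le
      _ = (π ^ 6 / 768 + π ^ 4 / 96) / (N : ℝ) ^ 2 := by field_simp; ring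
      _ ≤ _ := by
          have : 0 ≤ π ^ 2 / 48 * (D * (Lc : ℝ) ^ 2 + 2 * Lc) / (N : ℝ) ^ 2 * 1 := by positivity
          linarith
  · rw [if_neg hz0, zero_add]
    obtain ⟨-, -, hm1⟩ := inv_symN_le_off_zero hNN' hq hq0 hz hz0
    have hE : ‖eM Lc (qv q z l)‖ ≤ 2 := norm_eM_le_two Lc _
    have hd : ‖dhat (ofRealVec q) l'‖ ≤ 2 := by
      rw [SymbolTaylor.norm_dhat_ofRealVec]; have := Real.abs_sin_le_one (q l' / 2); linarith
    have hpre : (Lc : ℝ) * ‖dhat (ofRealVec q) l'‖ * ‖eM Lc (qv q z l)‖ ≤ Lc * 2 * 2 := by gcongr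
    have hA : ‖∏ i, pairP N' M' (qv q z i) - ∏ i, pairP N M (qv q z i)‖
        ≤ π ^ 2 / 6 * Lc / (N : ℝ) ^ 2 * ∑ i, ∏ j ∈ Finset.univ.erase i, mP Lc (z j) :=
      norm_prod_pairP_sub_le hN hM hN' hM' hLc hNMr hN'M'r hNN' hq hQ
    have hv32 : ∀ i, 32 * ((symN N' (qv q z))⁻¹ ^ 2 / 2) ≤ mP Lc (z i) := fun i => by
      have := inv_symN_sq_le_mP hNN' hLc1 hq hq0 hz hz0 i; linarith
    have hborrow := sum_prod_erase_mul_le z hv32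
    have hvm : π ^ 4 / 96 / (N : ℝ) ^ 2 * (momSq (qv q z))⁻¹ ≤ π ^ 4 / 96 / (N : ℝ) ^ 2 * (π ^ 2)⁻¹ :=
      mul_le_mul_of_nonneg_left hm1 (by positivity)
    have h1 : ‖∏ i, pairP N' M' (qv q z i) - ∏ i, pairP N M (qv q z i)‖ * ((symN N' (qv q z))⁻¹ ^ 2 / 2)
        ≤ π ^ 2 / 6 * Lc / (N : ℝ) ^ 2 * (D * ∏ j, mP Lc (z j)) / 32 := by
      calc _ ≤ (π ^ 2 / 6 * Lc / (N : ℝ) ^ 2 * ∑ i, ∏ j ∈ Finset.univ.erase i, mP Lc (z j)) * ((symN N' (qv q z))⁻¹ ^ 2 / 2) :=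
            mul_le_mul_of_nonneg_right hA (by positivity)
        _ = π ^ 2 / 6 * Lc / (N : ℝ) ^ 2 *
              ((∑ i, ∏ j ∈ Finset.univ.erase i, mP Lc (z j)) * (32 * ((symN N' (qv q z))⁻¹ ^ 2 / 2))) / 32 := by ring
        _ ≤ _ := by gcongr
    have h2 : ‖∏ i, pairP N M (qv q z i)‖ * |(symN N' (qv q z))⁻¹ ^ 2 / 2 - (symN N (qv q z))⁻¹ ^ 2 / 2|
        ≤ (∏ j, mP Lc (z j)) * (π ^ 4 / 96 / (N : ℝ) ^ 2 * (π ^ 2)⁻¹) := mul_le_mul hP (hv.trans hvm) (abs_nonneg _) hPm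
    calc _ ≤ ((Lc : ℝ) * 2 * 2) * (π ^ 2 / 6 * Lc / (N : ℝ) ^ 2 * (D * ∏ j, mP Lc (z j)) / 32
            + (∏ j, mP Lc (z j)) * (π ^ 4 / 96 / (N : ℝ) ^ 2 * (π ^ 2)⁻¹)) :=
          mul_le_mul hpre (hsplit.trans (add_le_add h1 h2)) (norm_nonneg _) (by positivity)
      _ = π ^ 2 / 48 * (D * (Lc : ℝ) ^ 2 + 2 * Lc) / (N : ℝ) ^ 2 * ∏ i, mP Lc (z i) := by field_simp; ring

/-- **MATCHED-LABEL RATE OF THE `S_φ` MODEL**: at a label `Q = q + 2πz` of the level-`N` box, two steps `N = M·Lc ≤ N′ = M′·Lc`,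
`‖termPhi_{N′}(Q) − termPhi_N(Q)‖ ≤ [z = 0]·(π²/48 + π⁴/48 + π⁶/768)/N² + (π²/48)(D·Lc² + (D+3)·Lc + 1)/N² · Π_i mP Lc z_i` — `p`-UNIFORM.
[folklore; our proof] -/
theorem norm_termPhi_sub_le (hNM : N = M * Lc) (hN'M' : N' = M' * Lc) (hNN' : N ≤ N') {q : Fin D → ℝ} (hq : ∀ i, |q i| ≤ π)
    (hq0 : q ≠ 0) (l' l : Fin D) (y' : Fin D → ℤ) {z : Fin D → ℤ} (hz : z ∈ boxZ N q) :
    ‖termPhi N' M' Lc q l' l y' (qv q z) - termPhi N M Lc q l' l y' (qv q z)‖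
      ≤ (if z = 0 then (π ^ 2 / 48 + π ^ 4 / 48 + π ^ 6 / 768) / (N : ℝ) ^ 2 else 0)
        + π ^ 2 / 48 * (D * (Lc : ℝ) ^ 2 + (D + 3) * Lc + 1) / (N : ℝ) ^ 2 * ∏ i, mP Lc (z i) := by
  have hδ := norm_deltaPart_sub_le hNM hN'M' hNN' hq hq0 l hz
  have hπp := norm_projPart_sub_le hNM hN'M' hNN' hq hq0 l' l hz
  have hPm := prod_mP_nonneg Lc z
  have hπ := Real.pi_pos
  have e : termPhi N' M' Lc q l' l y' (qv q z) - termPhi N M Lc q l' l y' (qv q z)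
      = -(srcPh Lc y' (qv q z) *
          (((if l' = l then (∏ i, pairP N' M' (qv q z i)) * pairP N' M' (qv q z l) * ((((symN N' (qv q z))⁻¹ / 2 : ℝ)) : ℂ) else 0)
            - (if l' = l then (∏ i, pairP N M (qv q z i)) * pairP N M (qv q z l) * ((((symN N (qv q z))⁻¹ / 2 : ℝ)) : ℂ) else 0))
          - (((Lc : ℂ) * dhat (ofRealVec q) l' * eM Lc (qv q z l)) *
                ((∏ i, pairP N' M' (qv q z i)) * ((((symN N' (qv q z))⁻¹ ^ 2 / 2 : ℝ)) : ℂ))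
              - ((Lc : ℂ) * dhat (ofRealVec q) l' * eM Lc (qv q z l)) *
                ((∏ i, pairP N M (qv q z i)) * ((((symN N (qv q z))⁻¹ ^ 2 / 2 : ℝ)) : ℂ))))) := by
    rw [termPhi_eq_mul, termPhi_eq_mul]; ring
  rw [e, norm_neg, norm_mul, norm_srcPh, one_mul]
  refine (norm_sub_le _ _).trans ?_
  have hite : ‖(if l' = l then (∏ i, pairP N' M' (qv q z i)) * pairP N' M' (qv q z l) * ((((symN N' (qv q z))⁻¹ / 2 : ℝ)) : ℂ) else 0)
      - (if l' = l then (∏ i, pairP N M (qv q z i)) * pairP N M (qv q z l) * ((((symN N (qv q z))⁻¹ / 2 : ℝ)) : ℂ) else 0)‖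
      ≤ (if z = 0 then (π ^ 4 / 96 + π ^ 2 / 48) / (N : ℝ) ^ 2 else 0)
        + π ^ 2 / 48 * ((D + 1) * (Lc : ℝ) + 1) / (N : ℝ) ^ 2 * ∏ i, mP Lc (z i) := by
    by_cases hll : l' = l
    · rw [if_pos hll, if_pos hll]; exact hδ
    · rw [if_neg hll, if_neg hll, sub_zero, norm_zero]; positivity
  have hproj : ‖((Lc : ℂ) * dhat (ofRealVec q) l' * eM Lc (qv q z l)) *
          ((∏ i, pairP N' M' (qv q z i)) * ((((symN N' (qv q z))⁻¹ ^ 2 / 2 : ℝ)) : ℂ))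
        - ((Lc : ℂ) * dhat (ofRealVec q) l' * eM Lc (qv q z l)) *
          ((∏ i, pairP N M (qv q z i)) * ((((symN N (qv q z))⁻¹ ^ 2 / 2 : ℝ)) : ℂ))‖
      ≤ (if z = 0 then (π ^ 6 / 768 + π ^ 4 / 96) / (N : ℝ) ^ 2 else 0)
        + π ^ 2 / 48 * (D * (Lc : ℝ) ^ 2 + 2 * Lc) / (N : ℝ) ^ 2 * ∏ i, mP Lc (z i) := by
    rw [← mul_sub]; exact hπp
  refine (add_le_add hite hproj).trans (le_of_eq ?_)
  split_ifs <;> ring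

end Labels

end Summit.QuantumFields.BalabanUV.Beta.GAN24.SourceSideRatePhi

end
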